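import Summits.RiemannHypothesis.RiemannHypothesis.Theorems.UniversalFactorMediumYCells

/-!
# RiemannHypothesis / UniversalFactor — node values, weight tables and side sums (soundness, V)

Route `RiemannHypothesis/UniversalFactor`, crux `MediumKernelNoGo` (stmt-RiemannHypothesis-2577), line
`one-sided-average-sign-test`.  Loop invariants of the box checker `UniversalFactorMediumBoxDefs.lean`:
`osaNodeVals_inv` (the u-side evaluator `mem_osaH0` at every y-node `|x ∓ y_{cj}|`), `osaExpTab_inv` /
`osaWTabs_inv` (the weight tables enclose `e^{−a_k(2c+1)ρ_y}` and `e^{−a_k ρ_y x_j}`), `osaSideSum_inv`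
(the interval-weighted sum encloses `Σ ρ_y W_j Re H_0(x + σ y_{cj}) e^{−a y_{cj}}` for EVERY `a` of the box:
`e^{−ay} ∈ [e^{−a₂y}, e^{−a₁y}]`), `osaSideErr_inv` and `le_osaTailBound` (the scaled error terms
dominate the analytic ones of `UniversalFactorMediumYCells.lean`).  Registered sub-goal: `stub_osaExpTab`.
-/

set_option linter.dupNamespace false

noncomputable section

namespace Summit.RiemannHypothesis.RiemannHypothesis.Theorems

open MeasureTheory Set
open Literature.NumberTheory.LFunctions
open Literature.Analysis.ValidatedNumerics Literature.Analysis.ValidatedNumerics.NumericsMP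

/-! ## Points and y-nodes -/

/-- `ρ_y` of a point. [folklore] -/
theorem UniversalFactor.OsaPoint.yQ_cast (pt : UniversalFactor.OsaPoint) (hpt : 0 < pt.rhoYd) (c j : ℕ) :
    ((pt.yQ c j : ℚ) : ℝ) = (2 * c + 1) * ((pt.rhoYn : ℝ) / pt.rhoYd) + (pt.rhoYn : ℝ) / pt.rhoYd * UniversalFactor.osaNodeR j := by
  unfold UniversalFactor.OsaPoint.yQ UniversalFactor.osaNodeR UniversalFactor.osaGlS
  have h1 : (pt.rhoYd : ℝ) ≠ 0 := by exact_mod_cast hpt.ne'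
  push_cast
  field_simp

/-- The y-nodes are nonnegative: `(2c+1)ρ + ρ t_j ≥ 0`. [folklore] -/
theorem UniversalFactor.osa_ynode_nonneg {ρ : ℝ} (hρ : 0 ≤ ρ) (c : ℕ) {j : ℕ} (hj : j < 32) :
    0 ≤ (2 * c + 1) * ρ + ρ * UniversalFactor.osaNodeR j := by
  have h := abs_le.1 (UniversalFactor.abs_osaNodeR_le hj)
  have hc : (0:ℝ) ≤ c := Nat.cast_nonneg c
  nlinarith [h.1, mul_nonneg hc hρ]

/-- Flat sums over `i < 32·Cy` are double sums over cells and nodes. [folklore] -/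
theorem UniversalFactor.osa_sum_flat (F : ℕ → ℕ → ℝ) :
    ∀ Cy : ℕ, ∑ i ∈ Finset.range (32 * Cy), F (i / 32) (i % 32) =
      ∑ c ∈ Finset.range Cy, ∑ j ∈ Finset.range 32, F c j
  | 0 => by simp
  | Cy + 1 => by
      have e : ∑ i ∈ Finset.range (32 * Cy + 32), F (i / 32) (i % 32) =
          ∑ i ∈ Finset.range (32 * Cy), F (i / 32) (i % 32) +
            ∑ j ∈ Finset.range 32, F ((32 * Cy + j) / 32) ((32 * Cy + j) % 32) :=
        Finset.sum_range_add _ _ _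
      have e3 : ∑ j ∈ Finset.range 32, F ((32 * Cy + j) / 32) ((32 * Cy + j) % 32) = ∑ j ∈ Finset.range 32, F Cy j :=
        Finset.sum_congr rfl fun j hj => by
          have hj' := Finset.mem_range.1 hj
          rw [show (32 * Cy + j) / 32 = Cy by omega, show (32 * Cy + j) % 32 = j by omega]
      rw [show (32 * (Cy + 1) : ℕ) = 32 * Cy + 32 by ring, e, UniversalFactor.osa_sum_flat F Cy, e3,
        Finset.sum_range_succ (fun c => ∑ j ∈ Finset.range 32, F c j) Cy]

/-! ## The node values of a side -/

/-- The sign of a side: backward `x − y` (`σ = −1`) or forward `x + y` (`σ = 1`). [folklore] -/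
theorem UniversalFactor.osa_sigma_abs (bwd : Bool) : |(if bwd then (-1:ℝ) else 1)| ≤ 1 := by
  cases bwd <;> simp

/-- **The node values**: `vals[c*32+j] ∋ Re H_0(x + σ y_{cj})`. [folklore] -/
theorem UniversalFactor.osaNodeVals_inv {C : UniversalFactor.OsaCtx} (hV : C.Valid) (pt : UniversalFactor.OsaPoint)
    (hxd : 0 < pt.xd) (hyd : 0 < pt.rhoYd) (bwd : Bool) :
    ∀ (fuel i : ℕ) (arr : Array MI) {vals : Array MI},
      UniversalFactor.osaNodeVals C pt bwd fuel i arr = some vals → arr.size = i →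
      (∀ i' < i, MI.mem C.S (deBruijnH 0 ((((pt.xn : ℝ) / pt.xd + (if bwd then (-1:ℝ) else 1) *
          ((2 * (i' / 32 : ℕ) + 1) * ((pt.rhoYn : ℝ) / pt.rhoYd) +
            (pt.rhoYn : ℝ) / pt.rhoYd * UniversalFactor.osaNodeR (i' % 32)) : ℝ)) : ℂ)).re
          (arr.getD i' (MI.ofInt C.S 0))) →
      vals.size = i + fuel ∧
      ∀ i' < i + fuel, MI.mem C.S (deBruijnH 0 ((((pt.xn : ℝ) / pt.xd + (if bwd then (-1:ℝ) else 1) *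
          ((2 * (i' / 32 : ℕ) + 1) * ((pt.rhoYn : ℝ) / pt.rhoYd) +
            (pt.rhoYn : ℝ) / pt.rhoYd * UniversalFactor.osaNodeR (i' % 32)) : ℝ)) : ℂ)).re
          (vals.getD i' (MI.ofInt C.S 0))
  | 0, i, arr, vals, h, hsz, hP => by
      simp only [UniversalFactor.osaNodeVals, Option.some.injEq] at h
      subst h
      exact ⟨by simpa using hsz, by simpa using hP⟩
  | fuel + 1, i, arr, vals, h, hsz, hP => by
      simp only [UniversalFactor.osaNodeVals] at h
      split at h
      · rename_i v hv
        set x'q : ℚ := (if bwd then (pt.xn : ℚ) / pt.xd - pt.yQ (i / 32) (i % 32)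
          else (pt.xn : ℚ) / pt.xd + pt.yQ (i / 32) (i % 32)) with hx'q
        have hax : 0 ≤ |x'q| := abs_nonneg _
        have hmem := UniversalFactor.mem_osaH0 hV (Rat.den_pos _) hv
        have hval : (((|x'q|.num.toNat : ℕ) : ℝ) / (|x'q|.den : ℕ) : ℝ) = |((x'q : ℚ) : ℝ)| := by
          have hn : 0 ≤ |x'q|.num := Rat.num_nonneg.2 hax
          have : ((|x'q|.num.toNat : ℕ) : ℤ) = |x'q|.num := Int.toNat_of_nonneg hn
          rw [← Rat.cast_abs, Rat.cast_def |x'q|]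
          congr 1
          exact_mod_cast this
        rw [hval, UniversalFactor.osa_re_deBruijnH_zero_abs] at hmem
        have hx' : ((x'q : ℚ) : ℝ) = (pt.xn : ℝ) / pt.xd + (if bwd then (-1:ℝ) else 1) *
            ((2 * (i / 32 : ℕ) + 1) * ((pt.rhoYn : ℝ) / pt.rhoYd) +
              (pt.rhoYn : ℝ) / pt.rhoYd * UniversalFactor.osaNodeR (i % 32)) := by
          rw [hx'q]
          cases bwd
          · simp only [Bool.false_eq_true, if_false]; push_cast; rw [UniversalFactor.OsaPoint.yQ_cast pt hyd]; ring
          · simp only [if_true]; push_cast; rw [UniversalFactor.OsaPoint.yQ_cast pt hyd]; ring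
        rw [hx'] at hmem
        have ih := UniversalFactor.osaNodeVals_inv hV pt hxd hyd bwd fuel (i + 1) _ h (by simp [hsz]) ?_
        · exact ⟨by rw [ih.1]; ring, fun i' hi' => ih.2 i' (by omega)⟩
        · intro i' hi'
          simp only [Array.getD_eq_getD_getElem?, Array.getElem?_push]
          by_cases he : i' = i
          · subst he
            simp only [hsz, if_true, Option.getD_some]
            exact hmem
          · have hlt : i' < i := by omega
            simp only [hsz, he, if_false]
            have := hP i' hlt
            simp only [Array.getD_eq_getD_getElem?] at this
            exact this
      · simp at h

/-! ## The interval-weighted side sum -/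

/-- `e^{−ay} ∈ [lo(e^{−a₂y}), hi(e^{−a₁y})]` for `a₁ ≤ a ≤ a₂`, `y ≥ 0`. [folklore] -/
theorem UniversalFactor.osa_mem_weight {S : ℕ} {a a₁ a₂ y : ℝ} (h1 : a₁ ≤ a) (h2 : a ≤ a₂) (hy : 0 ≤ y)
    {elo ehi : MI} (hlo : MI.mem S (Real.exp (-(a₂ * y))) elo) (hhi : MI.mem S (Real.exp (-(a₁ * y))) ehi) :
    MI.mem S (Real.exp (-(a * y))) ⟨elo.lo, ehi.hi⟩ := by
  have hS : (0:ℝ) ≤ S := Nat.cast_nonneg S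
  constructor
  · refine hlo.1.trans (mul_le_mul_of_nonneg_right (Real.exp_le_exp.2 ?_) hS)
    nlinarith
  · refine le_trans (mul_le_mul_of_nonneg_right (Real.exp_le_exp.2 ?_) hS) hhi.2
    nlinarith

/-- `ofFrac S (±(A·y)).num ((±(A·y)).den · AD) ∋ ±(A/AD)·y`. [folklore] -/
theorem UniversalFactor.osa_mem_ofFrac_divAD (S : ℕ) (q : ℚ) {AD : ℕ} (hAD : 0 < AD) :
    MI.mem S (((q : ℚ) : ℝ) / AD) (MI.ofFrac S q.num (q.den * AD)) := by
  have h := MI.mem_ofFrac S q.num (q := q.den * AD) (Nat.mul_pos q.den_pos hAD)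
  refine UniversalFactor.osa_mem_congr h ?_
  rw [Rat.cast_def q]; push_cast
  rw [div_div]

/-- **The exp table** encloses `e^{−(A/AD) f(k')}` at every index. [folklore] -/
theorem UniversalFactor.osaExpTab_inv {C : UniversalFactor.OsaCtx} (hS : 0 < C.S) (A : ℕ) {AD : ℕ} (hAD : 0 < AD)
    (f : ℕ → ℚ) :
    ∀ (fuel k : ℕ) (arr : Array MI) {res : Array MI},
      UniversalFactor.osaExpTab C A AD f fuel k arr = some res → arr.size = k →
      (∀ k' < k, MI.mem C.S (Real.exp (-((A : ℝ) / AD * ((f k' : ℚ) : ℝ)))) (arr.getD k' (MI.ofInt C.S 0))) →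
      res.size = k + fuel ∧
      ∀ k' < k + fuel, MI.mem C.S (Real.exp (-((A : ℝ) / AD * ((f k' : ℚ) : ℝ)))) (res.getD k' (MI.ofInt C.S 0))
  | 0, k, arr, res, h, hsz, hP => by
      simp only [UniversalFactor.osaExpTab, Option.some.injEq] at h
      subst h
      exact ⟨by simpa using hsz, by simpa using hP⟩
  | fuel + 1, k, arr, res, h, hsz, hP => by
      simp only [UniversalFactor.osaExpTab] at h
      split at h
      · rename_i E hE
        have hmem : MI.mem C.S (Real.exp (-((A : ℝ) / AD * ((f k : ℚ) : ℝ)))) E := by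
          refine MI.mem_exp hS hE (UniversalFactor.osa_mem_congr (UniversalFactor.osa_mem_ofFrac_divAD C.S _ hAD) ?_)
          push_cast; ring
        have ih := UniversalFactor.osaExpTab_inv hS A hAD f fuel (k + 1) _ h (by simp [hsz]) ?_
        · exact ⟨by rw [ih.1]; ring, fun k' hk' => ih.2 k' (by omega)⟩
        · intro k' hk'
          simp only [Array.getD_eq_getD_getElem?, Array.getElem?_push]
          by_cases he : k' = k
          · subst he
            simp only [hsz, if_true, Option.getD_some]
            exact hmem
          · have hlt : k' < k := by omega
            simp only [hsz, he, if_false]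
            have := hP k' hlt
            simp only [Array.getD_eq_getD_getElem?] at this
            exact this
      · simp at h

/-- **The weight tables** of a side enclose the cell factors `e^{−a_k(2c+1)ρ_y}` and the node factors
`e^{−a_k ρ_y x_j}`. [folklore] -/
theorem UniversalFactor.osaWTabs_inv {C : UniversalFactor.OsaCtx} (hS : 0 < C.S) (pt : UniversalFactor.OsaPoint)
    {A₁ A₂ AD Cy : ℕ} (hAD : 0 < AD) {W : Array MI × Array MI × Array MI × Array MI}
    (h : UniversalFactor.osaWTabs C pt A₁ A₂ AD Cy = some W) :
    (∀ c < Cy, MI.mem C.S (Real.exp (-((A₂ : ℝ) / AD * ((2 * c + 1) * ((pt.rhoYn : ℝ) / pt.rhoYd)))))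
      (W.1.getD c (MI.ofInt C.S 0))) ∧
    (∀ c < Cy, MI.mem C.S (Real.exp (-((A₁ : ℝ) / AD * ((2 * c + 1) * ((pt.rhoYn : ℝ) / pt.rhoYd)))))
      (W.2.1.getD c (MI.ofInt C.S 0))) ∧
    (∀ j < 32, MI.mem C.S (Real.exp (-((A₂ : ℝ) / AD * ((pt.rhoYn : ℝ) / pt.rhoYd * UniversalFactor.osaNodeR j))))
      (W.2.2.1.getD j (MI.ofInt C.S 0))) ∧
    (∀ j < 32, MI.mem C.S (Real.exp (-((A₁ : ℝ) / AD * ((pt.rhoYn : ℝ) / pt.rhoYd * UniversalFactor.osaNodeR j))))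
      (W.2.2.2.getD j (MI.ofInt C.S 0))) := by
  unfold UniversalFactor.osaWTabs at h
  dsimp only at h
  split at h
  · rename_i EC₂ EC₁ EJ₂ EJ₁ h2 h1 h4 h3
    simp only [Option.some.injEq] at h
    subst h
    have castc : ∀ c : ℕ, ((((2 * c + 1) * ((pt.rhoYn : ℚ) / pt.rhoYd) : ℚ)) : ℝ) =
        (2 * c + 1) * ((pt.rhoYn : ℝ) / pt.rhoYd) := fun c => by push_cast; ring
    have castj : ∀ j : ℕ, ((((pt.rhoYn : ℚ) / pt.rhoYd * UniversalFactor.osaNodeQ j : ℚ)) : ℝ) =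
        (pt.rhoYn : ℝ) / pt.rhoYd * UniversalFactor.osaNodeR j := fun j => by
      unfold UniversalFactor.osaNodeQ UniversalFactor.osaNodeR; push_cast; ring
    refine ⟨fun c hc => ?_, fun c hc => ?_, fun j hj => ?_, fun j hj => ?_⟩
    · have := (UniversalFactor.osaExpTab_inv hS A₂ hAD _ Cy 0 #[] h2 rfl (fun k' hk' => absurd hk' (by omega))).2 c
        (by omega)
      rwa [castc] at this
    · have := (UniversalFactor.osaExpTab_inv hS A₁ hAD _ Cy 0 #[] h1 rfl (fun k' hk' => absurd hk' (by omega))).2 c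
        (by omega)
      rwa [castc] at this
    · have := (UniversalFactor.osaExpTab_inv hS A₂ hAD _ 32 0 #[] h4 rfl (fun k' hk' => absurd hk' (by omega))).2 j
        (by omega)
      rwa [castj] at this
    · have := (UniversalFactor.osaExpTab_inv hS A₁ hAD _ 32 0 #[] h3 rfl (fun k' hk' => absurd hk' (by omega))).2 j
        (by omega)
      rwa [castj] at this
  · simp at h

/-- **The side sum** encloses `z + Σ_{i ≤ i' < i+fuel} ρW_{j} Re H_0(x + σ y_{i'}) e^{−a y_{i'}}` for every
`a ∈ [A₁/AD, A₂/AD]`. [folklore] -/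
theorem UniversalFactor.osaSideSum_inv {C : UniversalFactor.OsaCtx} (hV : C.Valid) (pt : UniversalFactor.OsaPoint)
    (hyn : 0 < pt.rhoYn) (hyd : 0 < pt.rhoYd) (σ : ℝ) (vals : Array MI) {A₁ A₂ AD Cy : ℕ} (hAD : 0 < AD)
    {a : ℝ} (ha1 : (A₁ : ℝ) / AD ≤ a) (ha2 : a ≤ (A₂ : ℝ) / AD)
    {W : Array MI × Array MI × Array MI × Array MI} (hW : UniversalFactor.osaWTabs C pt A₁ A₂ AD Cy = some W)
    (hvals : ∀ i' < 32 * Cy, MI.mem C.S (deBruijnH 0 ((((pt.xn : ℝ) / pt.xd + σ *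
          ((2 * (i' / 32 : ℕ) + 1) * ((pt.rhoYn : ℝ) / pt.rhoYd) +
            (pt.rhoYn : ℝ) / pt.rhoYd * UniversalFactor.osaNodeR (i' % 32)) : ℝ)) : ℂ)).re
          (vals.getD i' (MI.ofInt C.S 0))) :
    ∀ (fuel i : ℕ), i + fuel ≤ 32 * Cy → ∀ {acc : MI} {z : ℝ}, MI.mem C.S z acc →
      MI.mem C.S (z + ∑ i' ∈ Finset.Ico i (i + fuel),
        (pt.rhoYn : ℝ) / pt.rhoYd * UniversalFactor.osaWeightR (i' % 32) *
          ((deBruijnH 0 ((((pt.xn : ℝ) / pt.xd + σ *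
            ((2 * (i' / 32 : ℕ) + 1) * ((pt.rhoYn : ℝ) / pt.rhoYd) +
              (pt.rhoYn : ℝ) / pt.rhoYd * UniversalFactor.osaNodeR (i' % 32)) : ℝ)) : ℂ)).re *
          Real.exp (-(a * ((2 * (i' / 32 : ℕ) + 1) * ((pt.rhoYn : ℝ) / pt.rhoYd) +
              (pt.rhoYn : ℝ) / pt.rhoYd * UniversalFactor.osaNodeR (i' % 32))))))
        (UniversalFactor.osaSideSum C pt vals W fuel i acc)
  | 0, i, _, acc, z, hz => by
      simp only [UniversalFactor.osaSideSum]
      simpa using hz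
  | fuel + 1, i, hn, acc, z, hz => by
      simp only [UniversalFactor.osaSideSum]
      obtain ⟨hC2, hC1, hJ2, hJ1⟩ := UniversalFactor.osaWTabs_inv hV.hS pt hAD hW
      have hρ0 : 0 ≤ (pt.rhoYn : ℝ) / pt.rhoYd := by positivity
      have hc : i / 32 < Cy := by omega
      have hj : i % 32 < 32 := Nat.mod_lt _ (by norm_num)
      have hy0 : 0 ≤ (2 * (i / 32 : ℕ) + 1) * ((pt.rhoYn : ℝ) / pt.rhoYd) +
          (pt.rhoYn : ℝ) / pt.rhoYd * UniversalFactor.osaNodeR (i % 32) :=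
        UniversalFactor.osa_ynode_nonneg hρ0 _ hj
      have m2 : MI.mem C.S (Real.exp (-((A₂ : ℝ) / AD * ((2 * (i / 32 : ℕ) + 1) * ((pt.rhoYn : ℝ) / pt.rhoYd) +
          (pt.rhoYn : ℝ) / pt.rhoYd * UniversalFactor.osaNodeR (i % 32)))))
          (MI.mul C.S (W.1.getD (i / 32) (MI.ofInt C.S 0)) (W.2.2.1.getD (i % 32) (MI.ofInt C.S 0))) := by
        refine UniversalFactor.osa_mem_congr (MI.mem_mul hV.hS (hC2 _ hc) (hJ2 _ hj)) ?_
        rw [← Real.exp_add]; ring_nf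
      have m1 : MI.mem C.S (Real.exp (-((A₁ : ℝ) / AD * ((2 * (i / 32 : ℕ) + 1) * ((pt.rhoYn : ℝ) / pt.rhoYd) +
          (pt.rhoYn : ℝ) / pt.rhoYd * UniversalFactor.osaNodeR (i % 32)))))
          (MI.mul C.S (W.2.1.getD (i / 32) (MI.ofInt C.S 0)) (W.2.2.2.getD (i % 32) (MI.ofInt C.S 0))) := by
        refine UniversalFactor.osa_mem_congr (MI.mem_mul hV.hS (hC1 _ hc) (hJ1 _ hj)) ?_
        rw [← Real.exp_add]; ring_nf
      have mwt := UniversalFactor.osa_mem_weight ha1 ha2 hy0 m2 m1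
      have mv := hvals i (by omega)
      have mw : MI.mem C.S ((pt.rhoYn : ℝ) / pt.rhoYd * UniversalFactor.osaWeightR (i % 32))
          (MI.ofFrac C.S ((pt.rhoYn : ℚ) / pt.rhoYd * UniversalFactor.osaWeightQ (i % 32)).num
            ((pt.rhoYn : ℚ) / pt.rhoYd * UniversalFactor.osaWeightQ (i % 32)).den) := by
        refine UniversalFactor.osa_mem_congr (UniversalFactor.osa_mem_ofFracQ C.S _) ?_
        unfold UniversalFactor.osaWeightQ UniversalFactor.osaWeightR; push_cast; rfl
      have hterm := MI.mem_mul hV.hS (MI.mem_mul hV.hS mv mwt) mw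
      have hacc := MI.mem_add hz hterm
      have ih := UniversalFactor.osaSideSum_inv hV pt hyn hyd σ vals hAD ha1 ha2 hW hvals fuel (i + 1) (by omega) hacc
      have hii : i < i + (fuel + 1) := by omega
      rw [Finset.sum_eq_sum_Ico_succ_bot hii, show i + (fuel + 1) = i + 1 + fuel by ring]
      convert ih using 1
      ring

/-! ## The error terms of a side -/

/-- `e^{ad} ≤ max(e^{a₁d}, e^{a₂d})` for `a ∈ [a₁, a₂]`. [folklore] -/
theorem UniversalFactor.osa_exp_le_max {a a₁ a₂ d : ℝ} (h1 : a₁ ≤ a) (h2 : a ≤ a₂) :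
    Real.exp (a * d) ≤ max (Real.exp (a₁ * d)) (Real.exp (a₂ * d)) := by
  rcases le_or_gt 0 d with hd | hd
  · exact le_max_of_le_right (Real.exp_le_exp.2 (mul_le_mul_of_nonneg_right h2 hd))
  · exact le_max_of_le_left (Real.exp_le_exp.2 (by nlinarith))

/-- **The quadrature error sum of a side**: `(Σ_{c ≤ c' < c+fuel} 5 e^{−a(Y_{c'} − R)} D) · S ≤ r − acc`. [folklore] -/
theorem UniversalFactor.osaSideErr_inv {C : UniversalFactor.OsaCtx} (hV : C.Valid) (pt : UniversalFactor.OsaPoint)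
    {A₁ A₂ AD : ℕ} (hAD : 0 < AD) {a : ℝ} (ha1 : (A₁ : ℝ) / AD ≤ a) (ha2 : a ≤ (A₂ : ℝ) / AD)
    {D : ℝ} (hD : 0 ≤ D) {dS : ℤ} (hdS : D * C.S ≤ dS) :
    ∀ (fuel c : ℕ) (acc : ℤ) {r : ℤ}, UniversalFactor.osaSideErr C pt A₁ A₂ AD dS fuel c acc = some r →
      (∑ c' ∈ Finset.Ico c (c + fuel), 5 * Real.exp (-(a * ((2 * (c' : ℝ) + 1) * ((pt.rhoYn : ℝ) / pt.rhoYd) -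
          (pt.RYn : ℝ) / pt.RYd))) * D) * C.S ≤ r - acc
  | 0, c, acc, r, h => by
      simp only [UniversalFactor.osaSideErr, Option.some.injEq] at h
      subst h; simp
  | fuel + 1, c, acc, r, h => by
      simp only [UniversalFactor.osaSideErr] at h
      split at h
      · rename_i e1 e2 he1 he2
        have ih := UniversalFactor.osaSideErr_inv hV pt hAD ha1 ha2 hD hdS fuel (c + 1) _ h
        have hS := hV.hS
        have hSr : (0:ℝ) < C.S := by exact_mod_cast hS
        set d : ℚ := (pt.RYn : ℚ) / pt.RYd - (2 * c + 1) * ((pt.rhoYn : ℚ) / pt.rhoYd) with hd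
        have hdR : ((d : ℚ) : ℝ) = (pt.RYn : ℝ) / pt.RYd - (2 * (c : ℝ) + 1) * ((pt.rhoYn : ℝ) / pt.rhoYd) := by
          rw [hd]; push_cast; ring
        have m1 : MI.mem C.S (Real.exp ((A₁ : ℝ) / AD * d)) e1 := by
          refine MI.mem_exp hS he1 (UniversalFactor.osa_mem_congr (UniversalFactor.osa_mem_ofFrac_divAD C.S _ hAD) ?_)
          push_cast; ring
        have m2 : MI.mem C.S (Real.exp ((A₂ : ℝ) / AD * d)) e2 := by
          refine MI.mem_exp hS he2 (UniversalFactor.osa_mem_congr (UniversalFactor.osa_mem_ofFrac_divAD C.S _ hAD) ?_)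
          push_cast; ring
        have hmax : Real.exp (a * d) * C.S ≤ (max e1.hi e2.hi : ℤ) := by
          rcases le_total (Real.exp ((A₁ : ℝ) / AD * d)) (Real.exp ((A₂ : ℝ) / AD * d)) with hle | hle
          · have := (UniversalFactor.osa_exp_le_max (d := (d : ℝ)) ha1 ha2).trans (le_of_eq (max_eq_right hle))
            have h2 := m2.2
            push_cast; exact le_trans (mul_le_mul_of_nonneg_right this hSr.le) (h2.trans (by exact_mod_cast le_max_right _ _))
          · have := (UniversalFactor.osa_exp_le_max (d := (d : ℝ)) ha1 ha2).trans (le_of_eq (max_eq_left hle))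
            have h1 := m1.2
            push_cast; exact le_trans (mul_le_mul_of_nonneg_right this hSr.le) (h1.trans (by exact_mod_cast le_max_left _ _))
        have hE0 : 0 ≤ Real.exp (a * d) * C.S := by positivity
        have hc := Numerics.le_cdiv_mul_real (a := 5 * max e1.hi e2.hi * dS) (b := C.S) (by exact_mod_cast hS)
        push_cast at hc
        -- the term of cell c
        have hterm : 5 * Real.exp (-(a * ((2 * (c : ℝ) + 1) * ((pt.rhoYn : ℝ) / pt.rhoYd) - (pt.RYn : ℝ) / pt.RYd))) * D *
            C.S ≤ (Numerics.cdiv (5 * max e1.hi e2.hi * dS) C.S : ℝ) + 1 := by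
          have e : -(a * ((2 * (c : ℝ) + 1) * ((pt.rhoYn : ℝ) / pt.rhoYd) - (pt.RYn : ℝ) / pt.RYd)) = a * d := by
            rw [hdR]; ring
          rw [e]
          have h1 : 5 * Real.exp (a * d) * D * C.S * C.S ≤ 5 * ((max e1.hi e2.hi : ℤ) : ℝ) * dS := by
            have := mul_le_mul hmax hdS (by positivity) (le_trans hE0 hmax)
            nlinarith
          have h2 : 5 * Real.exp (a * d) * D * C.S ≤ 5 * ((max e1.hi e2.hi : ℤ) : ℝ) * dS / C.S := by
            rw [le_div_iff₀ hSr]; exact h1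
          have h3 : 5 * ((max e1.hi e2.hi : ℤ) : ℝ) * dS / C.S ≤ (Numerics.cdiv (5 * max e1.hi e2.hi * dS) C.S : ℝ) := by
            rw [div_le_iff₀ hSr]; push_cast; exact hc
          linarith
        have hcc : c < c + (fuel + 1) := by omega
        rw [Finset.sum_eq_sum_Ico_succ_bot hcc, show c + (fuel + 1) = c + 1 + fuel by ring, add_mul]
        push_cast at ih hterm ⊢
        linarith
      · simp at h

/-- **The tail term**: `(e^{−a₁Y}/a₁) · S ≤ osaTailBound`, `Y = 2Cyρ_y`, `a₁ = A₁/AD > 0`. [folklore] -/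
theorem UniversalFactor.le_osaTailBound {C : UniversalFactor.OsaCtx} (hV : C.Valid) (pt : UniversalFactor.OsaPoint)
    {A₁ AD Cy : ℕ} (hA : 0 < A₁) (hAD : 0 < AD) {T : ℤ} (h : UniversalFactor.osaTailBound C pt A₁ AD Cy = some T) :
    Real.exp (-((A₁ : ℝ) / AD * (2 * Cy * ((pt.rhoYn : ℝ) / pt.rhoYd)))) / ((A₁ : ℝ) / AD) * C.S ≤ T := by
  simp only [UniversalFactor.osaTailBound] at h
  split at h
  · rename_i e he
    simp only [Option.some.injEq] at h
    subst h
    have hS := hV.hS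
    have m := MI.mem_exp hS he (UniversalFactor.osa_mem_ofFrac_divAD C.S _ hAD)
    have hA' : (0:ℝ) < A₁ := by exact_mod_cast hA
    have hAD' : (0:ℝ) < AD := by exact_mod_cast hAD
    set Ex := Real.exp (-((A₁ : ℝ) / AD * (2 * Cy * ((pt.rhoYn : ℝ) / pt.rhoYd)))) with hEx
    have hm : Ex * C.S ≤ e.hi := by
      have := m.2
      refine le_trans (le_of_eq ?_) this
      rw [hEx]; push_cast; ring_nf
    have hc := Numerics.le_cdiv_mul_real (a := e.hi * AD) (b := A₁) (by exact_mod_cast hA)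
    push_cast at hc ⊢
    have h1 : Ex / ((A₁ : ℝ) / AD) * C.S = Ex * C.S * AD / A₁ := by field_simp
    rw [h1, div_le_iff₀ hA']
    nlinarith
  · simp at h

/-- **Registered sub-goal `stub_osaExpTab`** (the weight table has the requested length). [folklore] -/
theorem UniversalFactor.stub_osaExpTab :
    ∀ (C : UniversalFactor.OsaCtx), 0 < C.S → ∀ (A AD : ℕ), 0 < AD → ∀ (f : ℕ → ℚ) (fuel : ℕ)
      (res : Array Literature.Analysis.ValidatedNumerics.NumericsMP.MI),
      UniversalFactor.osaExpTab C A AD f fuel 0 #[] = some res → res.size = fuel :=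
  fun _ hS A _ hAD f fuel _ h =>
    ((UniversalFactor.osaExpTab_inv hS A hAD f fuel 0 #[] h rfl (fun k hk => absurd hk (Nat.not_lt_zero k))).1).trans
      (Nat.zero_add fuel)

end Summit.RiemannHypothesis.RiemannHypothesis.Theorems
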